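import Summits.BirchSwinnertonDyer.BirchSwinnertonDyer.Theorems.ClassRecordThreeEulerHalvesAtThreeEichlerShimuraTorsionCountB
import Summits.BirchSwinnertonDyer.BirchSwinnertonDyer.Theorems.ClassRecordThreeEulerHalvesAtThreeEichlerShimuraTorsionCountC
import HarnessLib

/-!
# The torsion-refined Shapiro count for a general finite-index level `Γ ∋ -1` over an arbitrary field `K`, part D: THE COUNT

Helper file (route `ClassRecordThree`, crux `EulerHalvesAtThree`, print residue (SIGᶜ-lift)(ii); seat bsd-idea-10 g24, `--supports
stmt-BirchSwinnertonDyer-19109 --as helper`). Port of the tree's `…LambdaCongruenceAtTwoSdTorsionShapiroCount` from `Γ₀(N)` to any finite-index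
`Γ ≤ SL(2, ℤ)` with `-1 ∈ Γ`: the comparison map `Λ(u, f) = ((E_u + δf)(S), (E_u + δf)(T))` on `H ⊕ K^X` (`H = parTorsCocycles K Γ`, part C) has
`dim ker Λ ≤ 1` and lands in the REFINED solution space `W = {(a, b) : a ∈ kerS, T^*a + b ∈ kerST, cusp sums of b = 0}` (the torsion conditions of
part C put `E(S)`, `E(ST)` in the elliptic-refined kernels of part A), whence by orbit counting (part B)

  `six_mul_finrank_parTorsCocycles_le'`: `6 dim_K H + 3ν₂(Γ) + 4ν₃(Γ) + 6ε_∞(Γ) ≤ 12 + [SL(2, ℤ) : Γ]`   for EVERY field `K`,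

i.e. `dim_K H¹_{par,tors}(Γ, K) ≤ 2g(X_Γ)` also in characteristic `2` and `3` — the input (F1_p) of the lifting recipe of
`…EichlerShimuraModLift.parabolicCochain_modLift_of_rankBound`. No named facts; nothing specific to BSD; no summit statement is proved.

## References
* G. Shimura, *Introduction to the arithmetic theory of automorphic functions* (1971), §8.1–8.2, Prop. 8.1, (8.2.24) [ShimuraIATAF1971].
* K. S. Brown, *Cohomology of groups* (1982), III.6 [Brown1982].
-/

noncomputable section

open scoped MatrixGroups ModularForm

open CongruenceSubgroup Matrix.SpecialLinearGroup ModularGroup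

set_option linter.dupNamespace false

namespace Summit.BirchSwinnertonDyer.BirchSwinnertonDyer.Theorems.EichlerShimuraLevelK

open _root_.Module _root_.LinearMap
open Literature.NumberTheory.EllipticCurves.ModularForms
open scoped Classical

variable {K : Type*} [Field K] {Γ : Subgroup SL(2, ℤ)}

/-- A coboundary `δf(g)` vanishes at the cosets fixed by `g`. [folklore] -/
theorem cobd_apply_eq_zero_of_smul_eq (f : (SL(2, ℤ) ⧸ Γ) → K) {g : SL(2, ℤ)} {x : (SL(2, ℤ) ⧸ Γ)}
    (hx : g • x = x) : cobd f g x = 0 := by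
  simp [cobd, hx]

/-! ### The comparison map `u ⊕ f ↦ ((E_u + δf)(S), (E_u + δf)(T))` and its kernel -/

variable (K Γ)

/-- `u ↦ (E_u(S), E_u(T))`. [folklore] -/
def liftPair : parTorsCocycles K Γ →ₗ[K] ((SL(2, ℤ) ⧸ Γ) → K) × ((SL(2, ℤ) ⧸ Γ) → K) where
  toFun u := (lift (u : Γ → K) S, lift (u : Γ → K) T)
  map_add' u v := by
    ext x <;> simp
  map_smul' c u := by
    ext x <;> simp

/-- `f ↦ (δf(S), δf(T))`. [folklore] -/
def cobdPair : ((SL(2, ℤ) ⧸ Γ) → K) →ₗ[K] ((SL(2, ℤ) ⧸ Γ) → K) × ((SL(2, ℤ) ⧸ Γ) → K) where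
  toFun f := (cobd f S, cobd f T)
  map_add' f f' := by
    ext x <;> simp [cobd] <;> ring
  map_smul' c f := by
    ext x <;> simp [cobd] <;> ring

/-- The **comparison map** `Λ(u, f) = ((E_u + δf)(S), (E_u + δf)(T))` on `H ⊕ K^X`. [folklore] -/
def lam : (parTorsCocycles K Γ × ((SL(2, ℤ) ⧸ Γ) → K)) →ₗ[K]
    ((SL(2, ℤ) ⧸ Γ) → K) × ((SL(2, ℤ) ⧸ Γ) → K) :=
  (liftPair K Γ).coprod (cobdPair K Γ)

/-- Unfolding `lam`. [folklore] -/
theorem lam_apply (p : parTorsCocycles K Γ × ((SL(2, ℤ) ⧸ Γ) → K)) :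
    lam K Γ p = (tot (p.1 : Γ → K) p.2 S, tot (p.1 : Γ → K) p.2 T) := rfl

/-- **The kernel of `Λ` is `0 ⊕ (constants)`**: if `(E_u + δf)(S) = (E_u + δf)(T) = 0` then `E_u + δf = 0`
on `SL(2, ℤ) = ⟨S, T⟩`, so `u(γ) = (E_u + δf)(γ)(Γ) = 0`, and then `g^*f = f` for all `g`, i.e. `f` is
constant (`SL(2, ℤ)` is transitive on `X`). [folklore] -/
theorem ker_lam_le (p : parTorsCocycles K Γ × ((SL(2, ℤ) ⧸ Γ) → K)) (hp : p ∈ LinearMap.ker (lam K Γ)) :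
    p.1 = 0 ∧ ∀ x, p.2 x = p.2 ((1 : SL(2, ℤ)) : (SL(2, ℤ) ⧸ Γ)) := by
  obtain ⟨u, f⟩ := p
  have hu := (mem_parTorsCocycles_iff.mp u.2).1
  rw [LinearMap.mem_ker, lam_apply, Prod.mk_eq_zero] at hp
  have hall := tot_eq_zero_of_S_T hu f hp.1 hp.2
  have hu0 : u = 0 := by
    apply Subtype.ext
    funext γ
    have h := tot_apply_coe_one hu f γ
    rw [hall, Pi.zero_apply] at h
    simp [← h]
  refine ⟨hu0, fun x ↦ ?_⟩
  have hcobd : ∀ g, cobd f g = 0 := fun g ↦ by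
    have h := hall g
    rw [tot, hu0] at h
    have h0 : lift ((0 : parTorsCocycles K Γ) : Γ → K) g = 0 := by
      funext y
      simp
    rwa [h0, zero_add] at h
  have hx : x = EichlerShimuraLevel.sec x • ((1 : SL(2, ℤ)) : (SL(2, ℤ) ⧸ Γ)) := by
    rw [MulAction.Quotient.smul_mk, smul_eq_mul, mul_one, EichlerShimuraLevel.coe_sec]
  have h := congr_fun (hcobd (EichlerShimuraLevel.sec x)) ((1 : SL(2, ℤ)) : (SL(2, ℤ) ⧸ Γ))
  rw [cobd, Pi.sub_apply, coperm_apply, Pi.zero_apply, sub_eq_zero, ← hx] at h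
  exact h

/-- `dim ker Λ ≤ 1`. [folklore] -/
theorem finrank_ker_lam_le_one : finrank K (LinearMap.ker (lam K Γ)) ≤ 1 := by
  let φ : LinearMap.ker (lam K Γ) →ₗ[K] K :=
    { toFun := fun p ↦ (p : parTorsCocycles K Γ × ((SL(2, ℤ) ⧸ Γ) → K)).2
        ((1 : SL(2, ℤ)) : (SL(2, ℤ) ⧸ Γ))
      map_add' := fun _ _ ↦ rfl
      map_smul' := fun _ _ ↦ rfl }
  have hφ : Function.Injective φ := by
    intro p q hpq
    obtain ⟨hp1, hp2⟩ := ker_lam_le K Γ p.1 p.2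
    obtain ⟨hq1, hq2⟩ := ker_lam_le K Γ q.1 q.2
    apply Subtype.ext
    apply Prod.ext
    · rw [hp1, hq1]
    · funext x
      rw [hp2 x, hq2 x]
      exact hpq
  have h := LinearMap.finrank_le_finrank_of_injective hφ
  rwa [Module.finrank_self] at h

/-- `u ↦ (E_u(S), E_u(T))` is injective on the parabolic–elliptic cocycles (the case `f = 0` of
`ker_lam_le`). [folklore] -/
theorem liftPair_injective : Function.Injective (liftPair K Γ) := by
  intro u v huv
  have h : (u - v, (0 : (SL(2, ℤ) ⧸ Γ) → K)) ∈ LinearMap.ker (lam K Γ) := by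
    rw [LinearMap.mem_ker, lam, LinearMap.coprod_apply, map_zero, add_zero, map_sub, huv, sub_self]
  exact sub_eq_zero.mp (ker_lam_le K Γ _ h).1

section Finite

variable [Γ.FiniteIndex]

/-- **`H = parTorsCocycles K Γ` is finite-dimensional** (`X` finite; it injects into `K^X × K^X` by `liftPair`;
cf. Shimura Prop. 8.3: a cocycle is determined by its values on generators). [folklore] -/
theorem finite_parTorsCocycles : Module.Finite K (parTorsCocycles K Γ) :=
  FiniteDimensional.of_injective (liftPair K Γ) (liftPair_injective K Γ)

/-! ### The refined solution space and the count -/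

/-- The **refined solution space** `W ⊆ K^X × K^X`: pairs `(a, b)` with `a ∈ kerS` (`(1 + S^*)a = 0`,
`a = 0` on the `S`-fixed cosets), `T^*a + b ∈ kerST` (`(1 + U + U²)(T^*a + b) = 0`, `T^*a + b = 0` on the
`ST`-fixed cosets) and `cusp sums of b = 0`. [folklore] -/
def solSpace : Submodule K (((SL(2, ℤ) ⧸ Γ) → K) × ((SL(2, ℤ) ⧸ Γ) → K)) :=
  (kerS K Γ).comap (LinearMap.fst K _ _) ⊓
    ((kerST K Γ).comap (coperm K Γ T ∘ₗ LinearMap.fst K _ _ + LinearMap.snd K _ _) ⊓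
      LinearMap.ker (cuspSum K Γ ∘ₗ LinearMap.snd K _ _))

/-- Membership in `solSpace`. [folklore] -/
theorem mem_solSpace_iff (p : ((SL(2, ℤ) ⧸ Γ) → K) × ((SL(2, ℤ) ⧸ Γ) → K)) :
    p ∈ solSpace K Γ ↔ p.1 ∈ kerS K Γ ∧ coperm K Γ T p.1 + p.2 ∈ kerST K Γ ∧ cuspSum K Γ p.2 = 0 := by
  simp [solSpace]

/-- **`Λ` lands in the refined solution space**: `(1 + S^*)E(S) = E(S²) = E(-1) = 0` and `E(S) = 0` on the
`S`-fixed cosets; `T^*E(S) + E(T) = E(ST)` satisfies `(1 + U + U²)E(ST) = E((ST)³) = E(-1) = 0` and vanishes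
on the `ST`-fixed cosets; the cusp sums of `E(T) = E_u(T) + T^*f - f` vanish. [folklore] -/
theorem range_lam_le [Fact ((-1 : SL(2, ℤ)) ∈ Γ)] : LinearMap.range (lam K Γ) ≤ solSpace K Γ := by
  rintro _ ⟨⟨u, f⟩, rfl⟩
  have hu := (mem_parTorsCocycles_iff.mp u.2).1
  have htors := (mem_parTorsCocycles_iff.mp u.2).2.2
  rw [mem_solSpace_iff, lam_apply]
  refine ⟨⟨?_, fun x hx ↦ ?_⟩, ?_, ?_⟩
  · have h := tot_mul hu f S S
    rw [S_mul_S_eq_neg_one, tot_neg_one htors] at h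
    rw [relS, LinearMap.add_apply, LinearMap.id_apply, add_comm]
    exact h.symm
  · change tot (u : Γ → K) f S x = 0
    rw [tot, Pi.add_apply, lift_S_apply_eq_zero u hx, cobd_apply_eq_zero_of_smul_eq f hx, add_zero]
  · have hST : coperm K Γ T (tot (u : Γ → K) f S) + tot (u : Γ → K) f T =
        tot (u : Γ → K) f (S * T) := (tot_mul hu f S T).symm
    rw [hST]
    refine ⟨?_, fun x hx ↦ ?_⟩
    · have h3 := tot_mul hu f (S * T * (S * T)) (S * T)
      rw [ParabolicCount.ST_pow_three_eq, tot_neg_one htors, tot_mul hu f (S * T) (S * T), map_add] at h3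
      rw [relST]
      simp only [LinearMap.add_apply, LinearMap.id_apply, LinearMap.comp_apply]
      rw [eq_comm] at h3
      convert h3 using 1
      abel
    · rw [tot, Pi.add_apply, lift_ST_apply_eq_zero u hx, cobd_apply_eq_zero_of_smul_eq f hx,
        add_zero]
  · change cuspSum K Γ (tot (u : Γ → K) f T) = 0
    rw [tot, map_add, cuspSum_lift_T u, zero_add, cobd, map_sub, cuspSum_coperm_T, sub_self]

/-- **`dim W ≤ dim kerS + dim(kerST ∩ ker(cusp sums))`**: project `W` to the first factor; the fibre over
`a = 0` is `kerST ∩ ker(cusp sums)`. [folklore] -/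
theorem finrank_solSpace_le :
    finrank K (solSpace K Γ) ≤ finrank K (kerS K Γ) +
      finrank K ↥(kerST K Γ ⊓ LinearMap.ker (cuspSum K Γ)) := by
  let π : solSpace K Γ →ₗ[K] ((SL(2, ℤ) ⧸ Γ) → K) := LinearMap.fst K _ _ ∘ₗ (solSpace K Γ).subtype
  have hπ := LinearMap.finrank_range_add_finrank_ker π
  have hrange : LinearMap.range π ≤ kerS K Γ := by
    rintro _ ⟨p, rfl⟩
    exact ((mem_solSpace_iff K Γ p.1).mp p.2).1
  have h1 := Submodule.finrank_mono hrange
  let ψ : LinearMap.ker π →ₗ[K] ((SL(2, ℤ) ⧸ Γ) → K) :=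
    LinearMap.snd K _ _ ∘ₗ (solSpace K Γ).subtype ∘ₗ (LinearMap.ker π).subtype
  have hker : ∀ p : LinearMap.ker π,
      ((p : solSpace K Γ) : ((SL(2, ℤ) ⧸ Γ) → K) × ((SL(2, ℤ) ⧸ Γ) → K)).1 = 0 :=
    fun p ↦ LinearMap.mem_ker.mp p.2
  have hψinj : Function.Injective ψ := by
    intro p q hpq
    apply Subtype.ext
    apply Subtype.ext
    exact Prod.ext (by rw [hker p, hker q]) hpq
  have hψrange : LinearMap.range ψ ≤ kerST K Γ ⊓ LinearMap.ker (cuspSum K Γ) := by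
    rintro _ ⟨p, rfl⟩
    obtain ⟨-, h2, h3⟩ := (mem_solSpace_iff K Γ _).mp (p : solSpace K Γ).2
    rw [hker p, map_zero, zero_add] at h2
    exact ⟨h2, h3⟩
  have h2 := Submodule.finrank_mono hψrange
  rw [LinearMap.finrank_range_of_inj hψinj] at h2
  omega

variable [Fintype (SL(2, ℤ) ⧸ Γ)]

/-- **`dim_K H¹_{par,tors}(Γ, K) ≤ 2g(X_Γ)` in EVERY characteristic**, in the form `6 dim_K H + 3ν₂ + 4ν₃ + 6ε_∞ ≤ 12 + μ` (`H = parTorsCocycles K Γ`,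
`μ = [SL(2, ℤ) : Γ]`, `ν₂ = #{x : Sx = x}`, `ν₃ = #{x : STx = x}`, `ε_∞` the number of cusps = base points; `12(2g) = 12 + μ - 3ν₂ - 4ν₃ - 6ε_∞`,
cf. the exact real count `…EichlerShimuraLevelCountE.six_mul_finrank_parabolicCocycles_eq`): `dim H + μ ≤ dim ker Λ + dim W ≤ 1 + dim kerS + dim kerST +
dim ker(cusp sums) + 1 - μ` with `2 dim kerS + ν₂ ≤ μ`, `3 dim kerST + 2ν₃ ≤ 2μ` (orbit counting, part B), `dim ker(cusp sums) = μ - ε_∞`.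
[cite: ShimuraIATAF1971, §8.2 (8.2.24) with Prop. 8.1 (case n = 0), here over an arbitrary field] -/
theorem six_mul_finrank_parTorsCocycles_le (hneg : (-1 : SL(2, ℤ)) ∈ Γ) :
    6 * finrank K (parTorsCocycles K Γ) + 3 * Level.nu₂Level Γ + 4 * Level.nu₃Level Γ +
        6 * (Level.basePoints Γ).card ≤
      12 + Γ.index := by
  haveI : Fact ((-1 : SL(2, ℤ)) ∈ Γ) := ⟨hneg⟩
  haveI := finite_parTorsCocycles K Γ
  -- notation and the numerical inputs
  have hμ : Γ.index = Fintype.card (SL(2, ℤ) ⧸ Γ) := by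
    rw [Subgroup.index, Nat.card_eq_fintype_card]
  have hε₂ : Level.nu₂Level Γ = (Finset.univ.filter fun q : (SL(2, ℤ) ⧸ Γ) ↦ S • q = q).card := by
    rw [Level.nu₂Level, Nat.card_eq_fintype_card, Fintype.card_subtype]
  have hε₃ : Level.nu₃Level Γ = (Finset.univ.filter fun q : (SL(2, ℤ) ⧸ Γ) ↦ (S * T) • q = q).card := by
    rw [Level.nu₃Level, Nat.card_eq_fintype_card, Fintype.card_subtype]
  -- orbit counting (part B) and the cusp sums (part A)
  have hA := two_mul_finrank_kerS_add_card_le (K := K) (Γ := Γ)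
  have hB := three_mul_finrank_kerST_add_card_le (K := K) (Γ := Γ)
  have hC := finrank_range_cuspSum (K := K) (Γ := Γ)
  have hC' := LinearMap.finrank_range_add_finrank_ker (cuspSum K Γ)
  rw [finrank_fintype_fun_eq_card] at hC'
  -- `dim (kerST ∩ ker C) + μ ≤ dim kerST + dim ker C + 1`
  have hsup := Submodule.finrank_sup_add_finrank_inf_eq (kerST K Γ) (LinearMap.ker (cuspSum K Γ))
  have hcodim := card_le_finrank_kerST_sup_add_one (K := K) (Γ := Γ)
  -- `dim H + μ = dim ker Λ + dim range Λ ≤ 1 + dim W`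
  have hΛ := LinearMap.finrank_range_add_finrank_ker (lam K Γ)
  rw [Module.finrank_prod, finrank_fintype_fun_eq_card] at hΛ
  have hker := finrank_ker_lam_le_one K Γ
  have hrange := Submodule.finrank_mono (range_lam_le K Γ)
  have hW := finrank_solSpace_le K Γ
  rw [hμ, hε₂, hε₃]
  omega

end Finite

/-- **The torsion-refined count without a chosen `Fintype` structure**: for a finite-index `Γ ∋ -1` and every field `K`,
`6 dim_K H¹_{par,tors}(Γ, K) + 3ν₂ + 4ν₃ + 6ε_∞ ≤ 12 + μ`. This is the input (F1_p) of the lifting recipe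
`…EichlerShimuraModLift.parabolicCochain_modLift_of_rankBound` (dossier `Cruxes/EulerHalvesAtThree/Lines/es-surj-gamma-transfer.md` §6), for `K = 𝔽_p`
and EVERY prime `p` including `2` and `3`. [cite: ShimuraIATAF1971, §8.2 (8.2.24), here over an arbitrary field] -/
theorem six_mul_finrank_parTorsCocycles_le' [Γ.FiniteIndex] (hneg : (-1 : SL(2, ℤ)) ∈ Γ) :
    6 * finrank K (parTorsCocycles K Γ) + 3 * Level.nu₂Level Γ + 4 * Level.nu₃Level Γ +
        6 * (Level.basePoints Γ).card ≤
      12 + Γ.index := by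
  letI : Fintype (SL(2, ℤ) ⧸ Γ) := Fintype.ofFinite _
  exact six_mul_finrank_parTorsCocycles_le K Γ hneg

end Summit.BirchSwinnertonDyer.BirchSwinnertonDyer.Theorems.EichlerShimuraLevelK

end
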